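import Mathlib.Algebra.Module.ZLattice.Basic
import Mathlib.NumberTheory.NumberField.CanonicalEmbedding.Basic
import Mathlib.MeasureTheory.Group.FundamentalDomain
import Literature.NumberTheory.Automorphic.AdelicAdditiveCharacter
import Literature.NumberTheory.Automorphic.AdicCompletionCompact
import Literature.NumberTheory.Automorphic.GLnCuspidalSpectrum
import HarnessLib

/-!
# Tate's additive fundamental domain for `K` in `𝔸_K`, and for `𝔫_k(K)` in `𝔫_k(𝔸_K)`

Trunk `AutomorphicAxiomatic` (G19), topic `NumberTheory/Automorphic`; namespace `Literature.Automorphic`.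

* `adeleFundamentalDomain K = D = D_∞ × ∏_v 𝒪_v ⊆ 𝔸_K` (Tate, Def. 4.1.2): the finite-integral
  adeles (`IsFiniteIntegral`) whose archimedean component lies in the fundamental parallelotope
  `D_∞` of the lattice `𝓞 K ⊆ K_∞ ≅ ℝ^{r₁} × ℂ^{r₂}` spanned by an integral basis (Mathlib
  `ZSpan.fundamentalDomain (latticeBasis K)`, transported along
  `InfiniteAdeleRing.ringEquiv_mixedSpace`).
* **Tate's Theorem 4.1.3 (1)** (`existsUnique_add_algebraMap_mem_adeleFundamentalDomain`):
  `𝔸_K = ⨆_{ξ ∈ K} (ξ + D)`, a disjoint union — every adele is congruent modulo `K` to exactly one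
  point of `D`; hence (`isAddFundamentalDomain_adeleFundamentalDomain`) `D` is a measurable
  fundamental domain (Mathlib `IsAddFundamentalDomain`) for the translation action of the
  principal adeles `AdeleRing.principalSubgroup`, for *every* measure on `𝔸_K`.
* `D` is relatively compact (Tate, Cor. 4.1.1; `isCompact_closure_adeleFundamentalDomain`,
  `exists_isCompact_adeleFundamentalDomain_subset`), so has finite Haar measure.
* The coordinatewise product `blockFundamentalDomain n k K = {X ∈ 𝔫_k(𝔸_K) | X i j ∈ D}` is a
  measurable, relatively compact fundamental domain for the translation action of
  `rationalBlock n k K = 𝔫_k(K)` on the block-nilpotent matrices `blockNilpotent n k (𝔸_K)`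
  (`isAddFundamentalDomain_blockFundamentalDomain`, for every measure): the pair `(ν, 𝓕)` over
  which `ConstantTermVanishes` (file `GLnCuspidalSpectrum`) quantifies exists, so the cuspidality
  condition can be *used* (specialised to `𝓕 = blockFundamentalDomain`).

## Proof

Tate's: bring `x` into `K_∞ × ∏ 𝒪_v` by a field element, unique modulo `𝓞 K`
(`exists_isFiniteIntegral_sub_algebraMap`, `isFiniteIntegral_algebraMap_iff` — his Lemma 4.1.3),
then adjust the archimedean component into `D_∞` by the unique lattice vector (Mathlib
`ZSpan.exist_unique_vadd_mem_fundamentalDomain` — his Lemma 4.1.4). Measurability: `D` is the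
intersection of the open set of finite-integral adeles with the preimage of the Borel set `D_∞`
under a continuous map; Mathlib's `IsAddFundamentalDomain.mk'` turns exact unique representability
into the fundamental-domain property for any measure. The block version is entrywise (entries
outside the block `i < k ≤ j` vanish and `0 ∈ D`).

## References

* J. Tate, *Fourier analysis in number fields and Hecke's zeta-functions*, in Cassels–Fröhlich
  (eds.), *Algebraic Number Theory* (1967), Ch. XV §4.1: Lemma 4.1.3, Lemma 4.1.4, Def. 4.1.2,
  Thm. 4.1.3, Cor. 4.1.1 (PDF pp. 357–358 of the held copy `book:editornd-algebraic-number-theory`).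
  [CasselsFrohlichANT1967]
-/

open NumberField IsDedekindDomain InfinitePlace mixedEmbedding MeasureTheory
open scoped RestrictedProduct

namespace Literature.NumberTheory.Automorphic

noncomputable section

section FD

variable (K : Type*) [Field K] [NumberField K]

open scoped Classical in
/-- The archimedean fundamental parallelotope `D_∞ ⊆ K_∞`: the preimage in `K_∞` of the
fundamental parallelotope `{∑ xᵢ ωᵢ | 0 ≤ xᵢ < 1}` of the lattice `𝓞 K ⊆ ℝ^{r₁} × ℂ^{r₂}` spanned by
an integral basis (Mathlib `ZSpan.fundamentalDomain (latticeBasis K)`), under Mathlib's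
`K_∞ ≅ ℝ^{r₁} × ℂ^{r₂}` (`InfiniteAdeleRing.ringEquiv_mixedSpace`). Tate, Lemma 4.1.4 (the
parallelotope `D̊`). [cite: CasselsFrohlichANT1967, Ch. XV Lemma 4.1.4] -/
def infiniteFundamentalDomain : Set (InfiniteAdeleRing K) :=
  (InfiniteAdeleRing.ringEquiv_mixedSpace K) ⁻¹' ZSpan.fundamentalDomain (latticeBasis K)

/-- **Tate's additive fundamental domain** `D = D_∞ × ∏_v 𝒪_v ⊆ 𝔸_K` for the translation action
of `K` on `𝔸_K`: the finite-integral adeles (`x_v ∈ 𝒪_v` for all finite `v`) whose archimedean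
component lies in the parallelotope `D_∞` (Tate, Def. 4.1.2).
[cite: CasselsFrohlichANT1967, Ch. XV Def. 4.1.2] -/
def adeleFundamentalDomain : Set (AdeleRing (𝓞 K) K) :=
  {x | IsFiniteIntegral K x ∧ x.1 ∈ infiniteFundamentalDomain K}

open scoped Classical in
/-- Membership in `D` (definitional unfolding). [folklore] -/
theorem mem_adeleFundamentalDomain {x : AdeleRing (𝓞 K) K} :
    x ∈ adeleFundamentalDomain K ↔ IsFiniteIntegral K x ∧
      InfiniteAdeleRing.ringEquiv_mixedSpace K x.1 ∈ ZSpan.fundamentalDomain (latticeBasis K) :=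
  Iff.rfl

open scoped Classical in
/-- `0 ∈ D` (all coordinates of `0` in the integral basis are `0 ∈ [0, 1)`). [folklore] -/
theorem zero_mem_adeleFundamentalDomain :
    (0 : AdeleRing (𝓞 K) K) ∈ adeleFundamentalDomain K := by
  refine ⟨isFiniteIntegral_zero K, ?_⟩
  change InfiniteAdeleRing.ringEquiv_mixedSpace K 0 ∈ ZSpan.fundamentalDomain (latticeBasis K)
  rw [map_zero]
  intro i
  simp

open scoped Classical in
/-- The `ℤ`-span of the lattice basis consists of the images of the global integers (Mathlib
`mem_span_latticeBasis`, restated with `𝓞 K`). [folklore] -/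
theorem mem_span_latticeBasis_iff {v : mixedSpace K} :
    v ∈ Submodule.span ℤ (Set.range (latticeBasis K)) ↔
      ∃ r : 𝓞 K, mixedEmbedding K (r : K) = v := by
  rw [mem_span_latticeBasis]
  constructor
  · rintro ⟨r, rfl⟩; exact ⟨r, rfl⟩
  · rintro ⟨r, rfl⟩; exact ⟨r, rfl⟩

open scoped Classical in
/-- **Tate's Theorem 4.1.3 (1): `𝔸_K = ⨆_{ξ ∈ K} (ξ + D)`, a disjoint union.** Every adele is
congruent modulo `K` to one and only one element of the additive fundamental domain `D`.
Proof as in Tate: a field element, unique modulo `𝓞 K`, brings `x` into `K_∞ × ∏_v 𝒪_v`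
(Lemma 4.1.3: `exists_isFiniteIntegral_sub_algebraMap`, `isFiniteIntegral_algebraMap_iff`), and
then a unique global integer moves the archimedean component into `D_∞` (Lemma 4.1.4: Mathlib
`ZSpan.exist_unique_vadd_mem_fundamentalDomain`, `mixedEmbedding_injective`).
[cite: CasselsFrohlichANT1967, Ch. XV Thm. 4.1.3 (1)] -/
theorem existsUnique_add_algebraMap_mem_adeleFundamentalDomain (x : AdeleRing (𝓞 K) K) :
    ∃! ξ : K, algebraMap K (AdeleRing (𝓞 K) K) ξ + x ∈ adeleFundamentalDomain K := by
  set e := InfiniteAdeleRing.ringEquiv_mixedSpace K with he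
  -- existence: first make `x` finite-integral, then adjust by a global integer at infinity
  obtain ⟨k₁, hk₁⟩ := exists_isFiniteIntegral_sub_algebraMap K x
  set y := x - algebraMap K (AdeleRing (𝓞 K) K) k₁ with hy
  obtain ⟨v, hv, -⟩ := ZSpan.exist_unique_vadd_mem_fundamentalDomain (latticeBasis K) (e y.1)
  obtain ⟨r, hr⟩ := (mem_span_latticeBasis_iff K).1 v.2
  have hexists :
      algebraMap K (AdeleRing (𝓞 K) K) ((r : K) - k₁) + x ∈ adeleFundamentalDomain K := by
    have hsplit : algebraMap K (AdeleRing (𝓞 K) K) ((r : K) - k₁) + x =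
        algebraMap K (AdeleRing (𝓞 K) K) (r : K) + y := by rw [map_sub, hy]; abel
    rw [hsplit]
    refine ⟨((isFiniteIntegral_algebraMap_iff K (r : K)).2 ⟨r, rfl⟩).add K hk₁, ?_⟩
    change e (algebraMap K (AdeleRing (𝓞 K) K) (r : K) + y).1 ∈
      ZSpan.fundamentalDomain (latticeBasis K)
    rw [show (algebraMap K (AdeleRing (𝓞 K) K) (r : K) + y).1 =
        algebraMap K (InfiniteAdeleRing K) (r : K) + y.1 from rfl, map_add,
      ← InfiniteAdeleRing.mixedEmbedding_eq_algebraMap_comp, hr]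
    exact hv
  refine ⟨(r : K) - k₁, hexists, fun ξ hξ => ?_⟩
  -- uniqueness
  set ξ₀ : K := (r : K) - k₁ with hξ₀
  have hdiff : IsFiniteIntegral K (algebraMap K (AdeleRing (𝓞 K) K) (ξ - ξ₀)) := by
    have := hξ.1.sub K hexists.1
    rwa [add_sub_add_right_eq_sub, ← map_sub] at this
  obtain ⟨s, hs⟩ := (isFiniteIntegral_algebraMap_iff K (ξ - ξ₀)).1 hdiff
  -- both archimedean parts lie in the parallelotope and differ by the lattice vector of `s`
  have h1 : e (algebraMap K (AdeleRing (𝓞 K) K) ξ + x).1 ∈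
      ZSpan.fundamentalDomain (latticeBasis K) := hξ.2
  have h2 : e (algebraMap K (AdeleRing (𝓞 K) K) ξ₀ + x).1 ∈
      ZSpan.fundamentalDomain (latticeBasis K) := hexists.2
  have hrel : e (algebraMap K (AdeleRing (𝓞 K) K) ξ + x).1 =
      mixedEmbedding K (s : K) + e (algebraMap K (AdeleRing (𝓞 K) K) ξ₀ + x).1 := by
    rw [InfiniteAdeleRing.mixedEmbedding_eq_algebraMap_comp, ← he, ← map_add]
    congr 1
    change algebraMap K (InfiniteAdeleRing K) ξ + x.1 =
      algebraMap K (InfiniteAdeleRing K) (s : K) + (algebraMap K (InfiniteAdeleRing K) ξ₀ + x.1)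
    rw [hs, map_sub]
    abel
  -- uniqueness in `ZSpan`
  set w : Submodule.span ℤ (Set.range (latticeBasis K)) :=
    ⟨mixedEmbedding K (s : K), (mem_span_latticeBasis_iff K).2 ⟨s, rfl⟩⟩ with hw
  obtain ⟨u, -, huniq⟩ := ZSpan.exist_unique_vadd_mem_fundamentalDomain (latticeBasis K)
    (e (algebraMap K (AdeleRing (𝓞 K) K) ξ₀ + x).1)
  have hu0 : (0 : Submodule.span ℤ (Set.range (latticeBasis K))) = u :=
    huniq 0 (by simpa using h2)
  have huw : w = u := huniq w (by
    change (mixedEmbedding K (s : K)) + _ ∈ _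
    rw [← hrel]; exact h1)
  have hs0 : mixedEmbedding K (s : K) = 0 := by
    have := congrArg (fun z : Submodule.span ℤ (Set.range (latticeBasis K)) => (z : mixedSpace K))
      (huw.trans hu0.symm)
    simpa [hw] using this
  have hs0' : (s : K) = 0 := (map_eq_zero_iff _ (mixedEmbedding_injective K)).1 hs0
  have : ξ - ξ₀ = 0 := by rw [← hs, hs0']
  exact sub_eq_zero.1 this

/-- Tate's Theorem 4.1.3 (1) for the translation action (Mathlib `AddSubgroup` action,
`g +ᵥ x = g + x`) of the subgroup of principal adeles: exactly one translate of every adele lies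
in `D`. [cite: CasselsFrohlichANT1967, Ch. XV Thm. 4.1.3 (1)] -/
theorem existsUnique_vadd_mem_adeleFundamentalDomain (x : AdeleRing (𝓞 K) K) :
    ∃! g : AdeleRing.principalSubgroup (𝓞 K) K, g +ᵥ x ∈ adeleFundamentalDomain K := by
  obtain ⟨ξ, hξ, huniq⟩ := existsUnique_add_algebraMap_mem_adeleFundamentalDomain K x
  refine ⟨⟨algebraMap K _ ξ, ξ, rfl⟩, ?_, ?_⟩
  · change algebraMap K (AdeleRing (𝓞 K) K) ξ + x ∈ adeleFundamentalDomain K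
    exact hξ
  · rintro ⟨g, ξ', rfl⟩ hg
    have : ξ' = ξ := huniq ξ' hg
    subst this
    rfl

open scoped Classical in
/-- **`D` is relatively compact** (Tate, Cor. 4.1.1, proof): it is contained in the closed compact
set `closure(D_∞) × ∏_v 𝒪_v` (`D_∞` is bounded, Mathlib `ZSpan.fundamentalDomain_isBounded`;
`∏_v 𝒪_v` is compact, `FiniteAdeleRing.isCompact_setOf_forall_mem` with
`compactSpace_adicCompletionIntegers'`). [cite: CasselsFrohlichANT1967, Ch. XV Cor. 4.1.1] -/
theorem exists_isCompact_adeleFundamentalDomain_subset :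
    ∃ C : Set (AdeleRing (𝓞 K) K), IsCompact C ∧ IsClosed C ∧ adeleFundamentalDomain K ⊆ C := by
  haveI : ∀ v : HeightOneSpectrum (𝓞 K), CompactSpace (v.adicCompletionIntegers K) :=
    compactSpace_adicCompletionIntegers' K
  set φ := infiniteAdeleRingHomeomorph K with hφ
  set Cinf : Set (InfiniteAdeleRing K) :=
    φ ⁻¹' closure (ZSpan.fundamentalDomain (latticeBasis K)) with hCinf
  set Cf : Set (FiniteAdeleRing (𝓞 K) K) := {a | ∀ v, a v ∈ v.adicCompletionIntegers K} with hCf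
  have hCinfc : IsCompact Cinf :=
    φ.isCompact_preimage.2 (ZSpan.fundamentalDomain_isBounded _).isCompact_closure
  have hCfc : IsCompact Cf := FiniteAdeleRing.isCompact_setOf_forall_mem (𝓞 K) K
  have hCfcl : IsClosed Cf := by
    have : Cf = ⋂ v, {a : FiniteAdeleRing (𝓞 K) K | a v ∈ v.adicCompletionIntegers K} := by
      ext a; simp [hCf]
    rw [this]
    refine isClosed_iInter fun v => ?_
    exact (Valued.isClosed_valuationSubring _).preimage (RestrictedProduct.continuous_eval v)
  refine ⟨show Set (AdeleRing (𝓞 K) K) from Cinf ×ˢ Cf, hCinfc.prod hCfc,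
    (isClosed_closure.preimage φ.continuous).prod hCfcl, ?_⟩
  rintro x ⟨hfin, hinf⟩
  exact ⟨subset_closure hinf, fun v => hfin v⟩

/-- `D` has compact closure (Tate, Cor. 4.1.1: "`D` is relatively compact").
[cite: CasselsFrohlichANT1967, Ch. XV Cor. 4.1.1] -/
theorem isCompact_closure_adeleFundamentalDomain :
    IsCompact (closure (adeleFundamentalDomain K)) := by
  obtain ⟨C, hC, hCcl, hDC⟩ := exists_isCompact_adeleFundamentalDomain_subset K
  exact hC.of_isClosed_subset isClosed_closure (closure_minimal hDC hCcl)

section Measure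

variable [MeasurableSpace (AdeleRing (𝓞 K) K)] [BorelSpace (AdeleRing (𝓞 K) K)]

omit [BorelSpace (AdeleRing (𝓞 K) K)] in
/-- `D` has finite measure for every measure finite on compact sets, e.g. every additive Haar
measure on `𝔸_K` (Tate, Thm. 4.1.3 (2) computes the measure to be `1` for his normalisation; only
finiteness is recorded here). [cite: CasselsFrohlichANT1967, Ch. XV Thm. 4.1.3 (2)] -/
theorem measure_adeleFundamentalDomain_lt_top (μ : Measure (AdeleRing (𝓞 K) K))
    [IsFiniteMeasureOnCompacts μ] : μ (adeleFundamentalDomain K) < ⊤ :=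
  (measure_mono subset_closure).trans_lt (isCompact_closure_adeleFundamentalDomain K).measure_lt_top

open scoped Classical in
/-- `D` is a Borel set: the intersection of the open set of finite-integral adeles
(`isOpen_setOf_isFiniteIntegral`) with the preimage of the Borel parallelotope (Mathlib
`ZSpan.fundamentalDomain_measurableSet`) under the continuous map `x ↦ x_∞ ↦ ℝ^{r₁} × ℂ^{r₂}`.
[folklore] -/
theorem measurableSet_adeleFundamentalDomain : MeasurableSet (adeleFundamentalDomain K) := by
  have h1 : MeasurableSet {x : AdeleRing (𝓞 K) K | IsFiniteIntegral K x} :=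
    (isOpen_setOf_isFiniteIntegral K).measurableSet
  have hc : Continuous fun x : AdeleRing (𝓞 K) K => infiniteAdeleRingHomeomorph K x.1 :=
    (infiniteAdeleRingHomeomorph K).continuous.comp continuous_fst
  have h2 : MeasurableSet ((fun x : AdeleRing (𝓞 K) K => infiniteAdeleRingHomeomorph K x.1) ⁻¹'
      ZSpan.fundamentalDomain (latticeBasis K)) :=
    hc.measurable (ZSpan.fundamentalDomain_measurableSet _)
  exact h1.inter h2

/-- **`D` is a measurable fundamental domain for the translation action of `K` on `𝔸_K`**
(Mathlib `IsAddFundamentalDomain`, via `IsAddFundamentalDomain.mk'` from exact unique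
representability), with respect to *every* measure on `𝔸_K`. Tate, Thm. 4.1.3 (1).
[cite: CasselsFrohlichANT1967, Ch. XV Thm. 4.1.3 (1)] -/
theorem isAddFundamentalDomain_adeleFundamentalDomain (μ : Measure (AdeleRing (𝓞 K) K)) :
    IsAddFundamentalDomain (AdeleRing.principalSubgroup (𝓞 K) K) (adeleFundamentalDomain K) μ :=
  IsAddFundamentalDomain.mk' (measurableSet_adeleFundamentalDomain K).nullMeasurableSet
    (existsUnique_vadd_mem_adeleFundamentalDomain K)

end Measure

end FD

section Block

variable (n k : ℕ) (K : Type) [Field K] [NumberField K]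

/-- The **block fundamental domain** `{X ∈ 𝔫_k(𝔸_K) | X i j ∈ D for all i, j}` for the translation
action of `𝔫_k(K) = rationalBlock n k K` on `𝔫_k(𝔸_K) = blockNilpotent n k 𝔸_K`: the product of
copies of Tate's `D` over the block entries `i < k ≤ j` (the other entries vanish, and `0 ∈ D`),
matching `𝔫_k(K) \ 𝔫_k(𝔸_K) ≅ (K \ 𝔸_K)^{k(n-k)}` (Borel–Jacquet (1979), §4.4). [folklore] -/
def blockFundamentalDomain : Set (blockNilpotent n k (AdeleRing (𝓞 K) K)) :=
  {X | ∀ i j, (X : Matrix (Fin n) (Fin n) (AdeleRing (𝓞 K) K)) i j ∈ adeleFundamentalDomain K}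

variable {n k K} in
/-- Membership in the block fundamental domain (definitional). [folklore] -/
theorem mem_blockFundamentalDomain {X : blockNilpotent n k (AdeleRing (𝓞 K) K)} :
    X ∈ blockFundamentalDomain n k K ↔
      ∀ i j, (X : Matrix (Fin n) (Fin n) (AdeleRing (𝓞 K) K)) i j ∈ adeleFundamentalDomain K :=
  Iff.rfl

/-- Every `X ∈ 𝔫_k(𝔸_K)` is congruent modulo `𝔫_k(K)` to one and only one point of the block
fundamental domain (Tate's Thm. 4.1.3 (1) entrywise; the correction matrix has entries
`algebraMap K 𝔸_K (ξ i j)` with `ξ i j = 0` outside the block, by uniqueness and `0 ∈ D`).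
[cite: CasselsFrohlichANT1967, Ch. XV Thm. 4.1.3 (1)] -/
theorem existsUnique_vadd_mem_blockFundamentalDomain (X : blockNilpotent n k (AdeleRing (𝓞 K) K)) :
    ∃! γ : rationalBlock n k K, γ +ᵥ X ∈ blockFundamentalDomain n k K := by
  have hX := X.2
  -- the unique rational correction of each entry
  choose ξ hξ huniq using fun i j : Fin n =>
    existsUnique_add_algebraMap_mem_adeleFundamentalDomain K
      ((X : Matrix (Fin n) (Fin n) (AdeleRing (𝓞 K) K)) i j)
  -- outside the block the entry is `0 ∈ D`, so the correction vanishes there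
  have hξ0 : ∀ i j : Fin n, ¬((i : ℕ) < k ∧ k ≤ (j : ℕ)) → ξ i j = 0 := by
    intro i j hij
    have hx0 : (X : Matrix (Fin n) (Fin n) (AdeleRing (𝓞 K) K)) i j = 0 :=
      apply_eq_zero_of_mem_blockNilpotent hX hij
    refine (huniq i j 0 ?_).symm
    change algebraMap K (AdeleRing (𝓞 K) K) 0 + (X : Matrix (Fin n) (Fin n) (AdeleRing (𝓞 K) K)) i j
      ∈ adeleFundamentalDomain K
    rw [map_zero, zero_add, hx0]
    exact zero_mem_adeleFundamentalDomain K
  set Γ : Matrix (Fin n) (Fin n) (AdeleRing (𝓞 K) K) :=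
    Matrix.of fun i j => algebraMap K (AdeleRing (𝓞 K) K) (ξ i j) with hΓ
  have hΓmem : Γ ∈ blockNilpotent n k (AdeleRing (𝓞 K) K) := by
    intro i j hne
    by_contra hij
    exact hne (by rw [hΓ, Matrix.of_apply, hξ0 i j hij, map_zero])
  have hΓrat : (⟨Γ, hΓmem⟩ : blockNilpotent n k (AdeleRing (𝓞 K) K)) ∈ rationalBlock n k K :=
    fun i j => ⟨ξ i j, rfl⟩
  refine ⟨⟨⟨Γ, hΓmem⟩, hΓrat⟩, fun i j => ?_, ?_⟩
  · change (Γ + (X : Matrix (Fin n) (Fin n) (AdeleRing (𝓞 K) K))) i j ∈ adeleFundamentalDomain K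
    rw [Matrix.add_apply, hΓ, Matrix.of_apply]
    exact hξ i j
  · rintro ⟨⟨Γ', hΓ'mem⟩, hΓ'rat⟩ hΓ'
    have hentry : ∀ i j, Γ' i j = Γ i j := by
      intro i j
      obtain ⟨ζ, hζ⟩ := hΓ'rat i j
      change algebraMap K (AdeleRing (𝓞 K) K) ζ = Γ' i j at hζ
      have hmem : algebraMap K (AdeleRing (𝓞 K) K) ζ +
          (X : Matrix (Fin n) (Fin n) (AdeleRing (𝓞 K) K)) i j ∈ adeleFundamentalDomain K := by
        have := hΓ' i j
        change (Γ' + (X : Matrix (Fin n) (Fin n) (AdeleRing (𝓞 K) K))) i j ∈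
          adeleFundamentalDomain K at this
        rwa [Matrix.add_apply, ← hζ] at this
      have hζξ : ζ = ξ i j := huniq i j ζ hmem
      rw [← hζ, hζξ, hΓ, Matrix.of_apply]
    have : Γ' = Γ := Matrix.ext hentry
    subst this
    rfl

/-- The block fundamental domain is a Borel set (finite intersection of preimages of the Borel set
`D` under the continuous entry maps; the σ-algebra on `𝔫_k(𝔸_K)` is Borel by
`instBorelSpaceBlockNilpotent`). [folklore] -/
theorem measurableSet_blockFundamentalDomain : MeasurableSet (blockFundamentalDomain n k K) := by
  letI : MeasurableSpace (AdeleRing (𝓞 K) K) := borel _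
  haveI : BorelSpace (AdeleRing (𝓞 K) K) := ⟨rfl⟩
  have : blockFundamentalDomain n k K = ⋂ i, ⋂ j,
      (fun X : blockNilpotent n k (AdeleRing (𝓞 K) K) =>
        (X : Matrix (Fin n) (Fin n) (AdeleRing (𝓞 K) K)) i j) ⁻¹' adeleFundamentalDomain K := by
    ext X; simp [mem_blockFundamentalDomain]
  rw [this]
  refine MeasurableSet.iInter fun i => MeasurableSet.iInter fun j => ?_
  have hc : Continuous fun X : blockNilpotent n k (AdeleRing (𝓞 K) K) =>
      (X : Matrix (Fin n) (Fin n) (AdeleRing (𝓞 K) K)) i j :=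
    (Continuous.matrix_elem continuous_subtype_val i j)
  exact hc.measurable (measurableSet_adeleFundamentalDomain K)

/-- **The block fundamental domain is a measurable fundamental domain for `𝔫_k(K)` acting on
`𝔫_k(𝔸_K)` by translation**, with respect to every measure (Mathlib `IsAddFundamentalDomain.mk'`).
In particular the pairs `(ν, 𝓕)` quantified over in `ConstantTermVanishes` exist (take any additive
Haar measure `ν` and `𝓕 = blockFundamentalDomain n k K`), so cuspidality can be specialised to
this domain. Borel–Jacquet (1979), §4.4 (`N(K) \ N(𝔸)` compact); Tate, Thm. 4.1.3.
[cite: CasselsFrohlichANT1967, Ch. XV Thm. 4.1.3 (1)] -/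
theorem isAddFundamentalDomain_blockFundamentalDomain
    (ν : Measure (blockNilpotent n k (AdeleRing (𝓞 K) K))) :
    IsAddFundamentalDomain (rationalBlock n k K) (blockFundamentalDomain n k K) ν :=
  IsAddFundamentalDomain.mk' (measurableSet_blockFundamentalDomain n k K).nullMeasurableSet
    (existsUnique_vadd_mem_blockFundamentalDomain n k K)

/-- The block fundamental domain is contained in a closed compact subset of `𝔫_k(𝔸_K)` (matrices
with all entries in the compact set of `exists_isCompact_adeleFundamentalDomain_subset`, traced on
the closed subgroup `𝔫_k(𝔸_K) ≤ M_n(𝔸_K)`). [cite: CasselsFrohlichANT1967, Ch. XV Cor. 4.1.1] -/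
theorem exists_isCompact_blockFundamentalDomain_subset :
    ∃ C : Set (blockNilpotent n k (AdeleRing (𝓞 K) K)), IsCompact C ∧ IsClosed C ∧
      blockFundamentalDomain n k K ⊆ C := by
  obtain ⟨C, hC, hCcl, hDC⟩ := exists_isCompact_adeleFundamentalDomain_subset K
  -- the set of matrices with all entries in `C` is compact, and its trace on the closed
  -- subgroup `𝔫_k(𝔸_K)` is compact
  set CM : Set (Matrix (Fin n) (Fin n) (AdeleRing (𝓞 K) K)) :=
    Set.univ.pi fun _ : Fin n => Set.univ.pi fun _ : Fin n => C with hCM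
  have hCMc : IsCompact CM := isCompact_univ_pi fun _ => isCompact_univ_pi fun _ => hC
  haveI : T2Space (FiniteAdeleRing (𝓞 K) K) := inferInstanceAs <| T2Space
    (Πʳ w : HeightOneSpectrum (𝓞 K), [w.adicCompletion K, w.adicCompletionIntegers K])
  haveI : T2Space (InfiniteAdeleRing K) :=
    inferInstanceAs <| T2Space ((w : InfinitePlace K) → w.Completion)
  haveI : T2Space (AdeleRing (𝓞 K) K) :=
    inferInstanceAs <| T2Space (InfiniteAdeleRing K × FiniteAdeleRing (𝓞 K) K)
  have hclosed : IsClosed (blockNilpotent n k (AdeleRing (𝓞 K) K) :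
      Set (Matrix (Fin n) (Fin n) (AdeleRing (𝓞 K) K))) := by
    have : (blockNilpotent n k (AdeleRing (𝓞 K) K) : Set (Matrix (Fin n) (Fin n) _)) =
        ⋂ i : Fin n, ⋂ j : Fin n, {M : Matrix (Fin n) (Fin n) (AdeleRing (𝓞 K) K) |
          ¬((i : ℕ) < k ∧ k ≤ (j : ℕ)) → M i j = 0} := by
      ext M
      simp only [SetLike.mem_coe, mem_blockNilpotent_iff, Set.mem_iInter, Set.mem_setOf_eq]
      exact ⟨fun h i j hij => by_contra fun hne => hij (h i j hne),
        fun h i j hne => by_contra fun hij => hne (h i j hij)⟩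
    rw [this]
    refine isClosed_iInter fun i => isClosed_iInter fun j => ?_
    by_cases hij : (i : ℕ) < k ∧ k ≤ (j : ℕ)
    · simp [hij]
    · simp only [hij, not_false_eq_true, forall_const]
      exact isClosed_eq (Continuous.matrix_elem continuous_id i j) continuous_const
  have hCMcl : IsClosed CM := isClosed_set_pi fun _ _ => isClosed_set_pi fun _ _ => hCcl
  refine ⟨Subtype.val ⁻¹' CM, hclosed.isClosedEmbedding_subtypeVal.isCompact_preimage hCMc,
    hCMcl.preimage continuous_subtype_val, fun X hX => ?_⟩
  exact Set.mem_univ_pi.2 fun i => Set.mem_univ_pi.2 fun j => hDC (hX i j)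

/-- The block fundamental domain has compact closure.
[cite: CasselsFrohlichANT1967, Ch. XV Cor. 4.1.1] -/
theorem isCompact_closure_blockFundamentalDomain :
    IsCompact (closure (blockFundamentalDomain n k K)) := by
  obtain ⟨C, hC, hCcl, hDC⟩ := exists_isCompact_blockFundamentalDomain_subset n k K
  exact hC.of_isClosed_subset isClosed_closure (closure_minimal hDC hCcl)

/-- The block fundamental domain has finite measure for every measure finite on compact sets, in
particular for every additive Haar measure on `𝔫_k(𝔸_K)`. [folklore] -/
theorem measure_blockFundamentalDomain_lt_top
    (ν : Measure (blockNilpotent n k (AdeleRing (𝓞 K) K))) [IsFiniteMeasureOnCompacts ν] :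
    ν (blockFundamentalDomain n k K) < ⊤ :=
  (measure_mono subset_closure).trans_lt
    (isCompact_closure_blockFundamentalDomain n k K).measure_lt_top

end Block

end

end Literature.NumberTheory.Automorphic
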